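import Literature.Geometry.ComplexHyperbolic.UnitBallCasimirTensorChart     -- ★ p843544 (this seat, (A4-0) FILE B): `sum_conj_frame_eq_casimir_pencil`, `casimir_pencil_rhs_smul`, chart ∕ sheet scaling
import Literature.Geometry.ComplexHyperbolic.UnitBallKCentralWallCurve       -- ★ p843546: the wall-curve datum (`contDiff_wallCurve_arg`, `exists_sq_support_bound_wallCurve`), ENGINE-T import
import Mathlib.Analysis.InnerProductSpace.Calculus                           -- `contDiff_norm_sq`
import HarnessLib

/-!
# The transversal sheet datum `Λ_χ` of the `K`-central orbital integrals of `U(2,1)`: the Casimir tensor in `ContinuousMultilinearMap` form, `C²` smoothness for `Θ ∈ C⁴`,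
# the uniform support bound, the blow-up identity, and ENGINE-T applied (ROAD A (A4-χ-DATUM); Rogawski 1990 §8.4)

Topic `Geometry/ComplexHyperbolic`; namespace `Literature.Geometry.ComplexHyperbolic.BallModel`.  THEOREMS ONLY (no `def`, no instance, no notation, no axiom, no named fact,
no `sorry`).  Cell `pub/hodgecm-mathlib`, ENGINE T1 (crux H413 = `stmt-HodgeConjecture-24833`); floor-1½ preparation, count-neutral, under row (S-d) ∕ «SdArch» ED. 3 node N1 =
the (L_{U(2,1)}) letter (`stub_ArchCentralLimitU21` ∕ closer `stub_L21`): brick **ROAD A (A4-χ-DATUM)** (ROAD A owner F0P3a-p05 (g13) «=» + SHAPE REQUEST 10:18:00Z, 2026-09-01: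
«`Λ_χ : ℝ × ℂ² × ℝ → G` on the triple `(t, W, r)`, `hΛ : ContDiff ℝ 2 Λ_χ`, `hS : ∀ t W r, S ≤ r² → Λ_χ (t,W,r) = 0`»; author A-p14 (g29)).  Over ★ (A4-0) `UnitBallCasimirTensorChart`
(this seat), ★ `UnitBallKCentralWallCurve` (p05: the wall-curve datum and its support bound), ★ ENGINE-T `UnitBallSheetFamilyDeriv`.  `open scoped Matrix.Norms.Operator` as the letter.

THE MATHEMATICS.  Along the compact-wall curve `k_t = diag(u_t, u_t, v_t)`, `u_t = ζe^{it}`, `v_t = ζe^{−2it}`, `v_t − u_t = −ε_t·b_t` with `ε_t = 2 sin(3t∕2)`, `b_t = iζe^{−it∕2}`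
(★ `coe_wallCurve_sub`), the transversal second derivative `N²Φ_Θ(k_t)` of the `K`-central orbital integral is (★ (A2″) `ArchCompactWallTransversalTrace`, in ball tokens)
`∫_{U(2,1)} ( ⅓Σ_a D²Θ(h_g)[u_t•Ad(g)y_a]² − DΘ(h_g)[u_t•(1 − P_g)] ) dμ(g)`, `h_g = u_t•1 + (v_t−u_t)•P_g`, `P_g = P(lift(g•x₀))`.  By ★ (A4-0) the bracket is `Ψ_t(P_g)` for the explicit
pencil function `Ψ_t(P) = ⅓·RHS(D²Θ(u_t•1 + (v_t−u_t)•P)[u_t•·, u_t•·], 1 − P) − DΘ(…)[u_t•(1 − P)]` (§1 states the Casimir identity for `B = D²Θ(h)` in the `ContinuousMultilinearMap` form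
of ★ p843385, through the `LinearMap.mk₂` adapter).  In the chart `P = −N(x(w,1))` and after the blow-up `W = √ε_t·w`:
  **`Λ_χ(t, W, r) := ⅓·RHS(D²Θ(h)[u_t•·, u_t•·], Π̃) − (r² − |W|²)•DΘ(h)[u_t•Π̃]`,  `h = u_t•1 + b_t•N(W₀,W₁,r)`,  `Π̃ = (r² − |W|²)•1 + N(W₀,W₁,r)`**
(`37` evaluations of `D²Θ(h)`, `DΘ(h)` at products of `Π̃` with CONSTANT matrix units; `r² − |W|² = ε` on the sheet `r = √(ε+|W|²)`), and **`ε² • Ψ_t(−N(x(w,1))) = Λ_χ(t, √ε•w, √(ε+|√ε•w|²))`**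
(§4 `sq_smul_transversalPencil_eq_datum` — so `ε_t⁴·N²Φ(k_t) = 9c·∫ Λ_χ(t, W, √(ε_t+|W|²)) d⁴W` once the orbital side is pushed to the ball and the chart, `d⁴(√ε w) = ε² d⁴w`).
* §2 `N(W,r)`, `|W|²`, `Π̃(W,r)` are smooth in `(t, W, r)` (entrywise polynomial; Pi-type transfer as in ★ `contDiff_wallCurve_arg`);
* §3 **`exists_sq_support_bound_transversalDatum`** (ONE `S` for all `t`: ★ `exists_sq_support_bound_wallCurve` for `D²Θ`, `DΘ`, which inherit the compact support) and
  **`contDiff_two_transversalDatum`**: `Θ ∈ C⁴ ⇒ ContDiff ℝ 2 Λ_χ` (`D²Θ(h)[X,Y] = (D(DΘ))(h)(X)(Y)`, Mathlib `iteratedFDeriv_two_apply`, then `ContDiff.clm_apply` twice — NB no type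
  ascription on `fderiv ℝ Θ`, ★ `UnitBallKCentralSecondOrder`);
* §5 **`contDiffOn_two_transversal_sheetIntegral`**: `t ↦ ∫ Λ_χ(t, W, √(2 sin(3t∕2)+|W|²)) d⁴W ∈ C²[0, δ]` for `0 < δ < 2π∕3`, `Θ ∈ C⁴_c` — ONE application of ★ `contDiffOn_two_integral_family`
  (the `hχ` of ★ (A4)-V `quarter_sub_eq_of_wallGerms` ∕ ★ (A4)-I, up to the identification `χ = m²·N²Φ(k_·) = c·(this)` on `(0, δ)`, orbital side: ★ p843385 → (A4-iv) bridge → ★ (A4-0) → §4).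
HONEST LABEL: HC_CM is proved only modulo the printed citations until rung 0 closes; this file is calculus over ★ ball-model files and pays nothing by itself.

## References
* [Rogawski1990] J. D. Rogawski, *Automorphic Representations of Unitary Groups in Three Variables*, Ann. of Math. Stud. 123 (1990), §8.4 pp. 126–127 (the singular orbital integrals at the compact
  wall of `U(2,1)`, normalised and differentiated twice on the way to the central limit formula).
* [Goldman1999] W. M. Goldman, *Complex Hyperbolic Geometry* (1999), §3.1.1 (negative lines, their `J`-projectors; the hyperboloid model).
* [Rudin1980] W. Rudin, *Function Theory in the Unit Ball of ℂⁿ* (1980), §1.4 (calculus and integration on `ℂⁿ`).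
* [Hall2015] B. C. Hall, *Lie Groups, Lie Algebras, and Representations*, 2nd ed., GTM 222 (2015), §3.5 (the adjoint action of `U(2)` on `𝔰𝔲(2)`).
-/

set_option autoImplicit false

noncomputable section

open MeasureTheory MeasureTheory.Measure Set Filter Topology Metric Matrix Complex
open scoped ENNReal Matrix.Norms.Operator ComplexConjugate

namespace Literature.Geometry.ComplexHyperbolic.BallModel

/-! ### §1 The Casimir identity for continuous bilinear maps in `ContinuousMultilinearMap` form (the shape of `D²Θ(h)[c•·, c•·]` in ★ p843385) -/

section Multilinear

variable {G : Type*} [NormedAddCommGroup G] [NormedSpace ℝ G]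

/-- ADAPTER: a continuous real-bilinear `B` on `M₃(ℂ)` with the complex scalar `c` inserted in both slots is a real bilinear map `q(X,Y) = B[c•X, c•Y]` (★ p843385 §5's `LinearMap.mk₂`).
[cite: Hall2015, §3.5] -/
theorem exists_bilin_eq_multilinear_smul (B : ContinuousMultilinearMap ℝ (fun _ : Fin 2 => Matrix (Fin 3) (Fin 3) ℂ) G) (c : ℂ) :
    ∃ q : Matrix (Fin 3) (Fin 3) ℂ →ₗ[ℝ] Matrix (Fin 3) (Fin 3) ℂ →ₗ[ℝ] G, ∀ X Y, q X Y = B ![c • X, c • Y] := by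
  have hadd0 : ∀ a b v : Matrix (Fin 3) (Fin 3) ℂ, B ![a + b, v] = B ![a, v] + B ![b, v] := fun a b v => B.toMultilinearMap.cons_add ![v] a b
  have hsmul0 : ∀ (r : ℝ) (a v : Matrix (Fin 3) (Fin 3) ℂ), B ![r • a, v] = r • B ![a, v] := fun r a v => B.toMultilinearMap.cons_smul ![v] r a
  have hupd : ∀ v x : Matrix (Fin 3) (Fin 3) ℂ, Function.update ![v, v] 1 x = ![v, x] := fun v x => by
    funext k; fin_cases k <;> simp
  have hadd1 : ∀ v a b : Matrix (Fin 3) (Fin 3) ℂ, B ![v, a + b] = B ![v, a] + B ![v, b] := fun v a b => by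
    rw [← hupd v (a + b), ← hupd v a, ← hupd v b]; exact B.map_update_add _ 1 a b
  have hsmul1 : ∀ (r : ℝ) (v a : Matrix (Fin 3) (Fin 3) ℂ), B ![v, r • a] = r • B ![v, a] := fun r v a => by
    rw [← hupd v (r • a), ← hupd v a]; exact B.map_update_smul _ 1 r a
  refine ⟨LinearMap.mk₂ ℝ (fun X Y => B ![c • X, c • Y]) (fun X X' Y => ?_) (fun r X Y => ?_) (fun X Y Y' => ?_) (fun r X Y => ?_), fun X Y => rfl⟩
  · simp only [smul_add, hadd0]
  · simp only [smul_comm c r, hsmul0]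
  · simp only [smul_add, hadd1]
  · simp only [smul_comm c r, hsmul1]

/-- **THE FRAME SUM IN `ContinuousMultilinearMap` FORM** (ROAD A (A4-0), the shape of ★ `iteratedDeriv_two_integral_wallLine_eq_integral_third_trace_sub_gradient`): for `g ∈ U(2,1)`,
`B` continuous real-bilinear on `M₃(ℂ)`, `c ∈ ℂ` (the torus coordinate `ζ_i` kept inside, `Θ` being only `ℝ`-differentiable) and `Π = 1 − P(lift(g • x₀))`:
`Σ_a B[c•Ad(g)y_a, c•Ad(g)y_a] = Σ_{k,l} ( re(J_kk J_ll) • (B[c•E_klΠ, c•ΠE_kl] + B[c•iE_klΠ, c•iΠE_kl]) − B[c•E_klΠ, c•E_lkΠ] + B[c•iE_klΠ, c•iE_lkΠ] ) − B[c•iΠ, c•iΠ]`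
(★ `sum_conj_frame_eq_casimir_pencil` through the adapter). [cite: Rogawski1990, §8.4 p. 126] [cite: Hall2015, §3.5] -/
theorem sum_conj_frame_eq_casimir_pencil_multilinear (g : U21) (B : ContinuousMultilinearMap ℝ (fun _ : Fin 2 => Matrix (Fin 3) (Fin 3) ℂ) G) (c : ℂ)
    (Pc : Matrix (Fin 3) (Fin 3) ℂ) (hPc : Pc = 1 - (((Q (lift (g • x₀)) : ℝ) : ℂ))⁻¹ • (vecMulVec (lift (g • x₀)) (star (lift (g • x₀))) * J)) :
    B ![c • (mat g * (I • (Matrix.single 0 0 (1 : ℂ) - Matrix.single 1 1 1)) * mat g⁻¹), c • (mat g * (I • (Matrix.single 0 0 (1 : ℂ) - Matrix.single 1 1 1)) * mat g⁻¹)] +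
      B ![c • (mat g * (Matrix.single 0 1 (1 : ℂ) - Matrix.single 1 0 1) * mat g⁻¹), c • (mat g * (Matrix.single 0 1 (1 : ℂ) - Matrix.single 1 0 1) * mat g⁻¹)] +
      B ![c • (mat g * (I • (Matrix.single 0 1 (1 : ℂ) + Matrix.single 1 0 1)) * mat g⁻¹), c • (mat g * (I • (Matrix.single 0 1 (1 : ℂ) + Matrix.single 1 0 1)) * mat g⁻¹)] =
      ((∑ k, ∑ l, ((J k k * J l l).re • (B ![c • (Matrix.single k l (1 : ℂ) * Pc), c • (Pc * Matrix.single k l (1 : ℂ))] +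
            B ![c • (I • (Matrix.single k l (1 : ℂ) * Pc)), c • (I • (Pc * Matrix.single k l (1 : ℂ)))]) -
          B ![c • (Matrix.single k l (1 : ℂ) * Pc), c • (Matrix.single l k (1 : ℂ) * Pc)] +
          B ![c • (I • (Matrix.single k l (1 : ℂ) * Pc)), c • (I • (Matrix.single l k (1 : ℂ) * Pc))])) -
        B ![c • (I • Pc), c • (I • Pc)]) := by
  obtain ⟨q, hq⟩ := exists_bilin_eq_multilinear_smul B c
  have h := sum_conj_frame_eq_casimir_pencil g q Pc hPc
  simpa only [hq] using h

/-- **HOMOGENEITY IN `ContinuousMultilinearMap` FORM**: `Π ↦ (a:ℂ)•Π` (`a` real) multiplies the right-hand side by `a²` (★ `casimir_pencil_rhs_smul` through the adapter).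
[cite: Rogawski1990, §8.4 p. 126] [cite: Hall2015, §3.5] -/
theorem casimir_pencil_rhs_smul_multilinear (B : ContinuousMultilinearMap ℝ (fun _ : Fin 2 => Matrix (Fin 3) (Fin 3) ℂ) G) (c : ℂ) (a : ℝ) (Pc : Matrix (Fin 3) (Fin 3) ℂ) :
    ((∑ k, ∑ l, ((J k k * J l l).re • (B ![c • (Matrix.single k l (1 : ℂ) * ((a : ℂ) • Pc)), c • (((a : ℂ) • Pc) * Matrix.single k l (1 : ℂ))] +
            B ![c • (I • (Matrix.single k l (1 : ℂ) * ((a : ℂ) • Pc))), c • (I • (((a : ℂ) • Pc) * Matrix.single k l (1 : ℂ)))]) -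
          B ![c • (Matrix.single k l (1 : ℂ) * ((a : ℂ) • Pc)), c • (Matrix.single l k (1 : ℂ) * ((a : ℂ) • Pc))] +
          B ![c • (I • (Matrix.single k l (1 : ℂ) * ((a : ℂ) • Pc))), c • (I • (Matrix.single l k (1 : ℂ) * ((a : ℂ) • Pc)))])) -
        B ![c • (I • ((a : ℂ) • Pc)), c • (I • ((a : ℂ) • Pc))]) =
      a ^ 2 • ((∑ k, ∑ l, ((J k k * J l l).re • (B ![c • (Matrix.single k l (1 : ℂ) * Pc), c • (Pc * Matrix.single k l (1 : ℂ))] +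
              B ![c • (I • (Matrix.single k l (1 : ℂ) * Pc)), c • (I • (Pc * Matrix.single k l (1 : ℂ)))]) -
            B ![c • (Matrix.single k l (1 : ℂ) * Pc), c • (Matrix.single l k (1 : ℂ) * Pc)] +
            B ![c • (I • (Matrix.single k l (1 : ℂ) * Pc)), c • (I • (Matrix.single l k (1 : ℂ) * Pc))])) -
          B ![c • (I • Pc), c • (I • Pc)]) := by
  obtain ⟨q, hq⟩ := exists_bilin_eq_multilinear_smul B c
  have h := casimir_pencil_rhs_smul q a Pc
  simpa only [hq] using h

/-- **BLOW-UP ALGEBRA (abstract)**: for a continuous real-bilinear `B`, a continuous real-linear `D`, `c ∈ ℂ`, `a ∈ ℝ` and `Π ∈ M₃(ℂ)`,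
`a² • (⅓·RHS(B, c, Π) − D(c•Π)) = ⅓·RHS(B, c, a•Π) − a • D(c•(a•Π))` — degree two of the Casimir part (★ `casimir_pencil_rhs_smul_multilinear`) and degree one of the gradient part.
[cite: Rogawski1990, §8.4 pp. 126–127] -/
theorem sq_smul_third_casimir_sub_apply_eq (B : ContinuousMultilinearMap ℝ (fun _ : Fin 2 => Matrix (Fin 3) (Fin 3) ℂ) G) (D : Matrix (Fin 3) (Fin 3) ℂ →L[ℝ] G)
    (c : ℂ) (a : ℝ) (Pc : Matrix (Fin 3) (Fin 3) ℂ) :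
    a ^ 2 • ((1 / 3 : ℝ) • ((∑ k, ∑ l, ((J k k * J l l).re • (B ![c • (Matrix.single k l (1 : ℂ) * Pc), c • (Pc * Matrix.single k l (1 : ℂ))] +
              B ![c • (I • (Matrix.single k l (1 : ℂ) * Pc)), c • (I • (Pc * Matrix.single k l (1 : ℂ)))]) -
            B ![c • (Matrix.single k l (1 : ℂ) * Pc), c • (Matrix.single l k (1 : ℂ) * Pc)] +
            B ![c • (I • (Matrix.single k l (1 : ℂ) * Pc)), c • (I • (Matrix.single l k (1 : ℂ) * Pc))])) -
          B ![c • (I • Pc), c • (I • Pc)]) - D (c • Pc)) =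
      (1 / 3 : ℝ) • ((∑ k, ∑ l, ((J k k * J l l).re • (B ![c • (Matrix.single k l (1 : ℂ) * (((a : ℝ) : ℂ) • Pc)), c • ((((a : ℝ) : ℂ) • Pc) * Matrix.single k l (1 : ℂ))] +
              B ![c • (I • (Matrix.single k l (1 : ℂ) * (((a : ℝ) : ℂ) • Pc))), c • (I • ((((a : ℝ) : ℂ) • Pc) * Matrix.single k l (1 : ℂ)))]) -
            B ![c • (Matrix.single k l (1 : ℂ) * (((a : ℝ) : ℂ) • Pc)), c • (Matrix.single l k (1 : ℂ) * (((a : ℝ) : ℂ) • Pc))] +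
            B ![c • (I • (Matrix.single k l (1 : ℂ) * (((a : ℝ) : ℂ) • Pc))), c • (I • (Matrix.single l k (1 : ℂ) * (((a : ℝ) : ℂ) • Pc)))])) -
          B ![c • (I • (((a : ℝ) : ℂ) • Pc)), c • (I • (((a : ℝ) : ℂ) • Pc))]) - a • D (c • (((a : ℝ) : ℂ) • Pc)) := by
  rw [casimir_pencil_rhs_smul_multilinear, smul_comm c (((a : ℝ) : ℂ)) Pc, Complex.coe_smul, D.map_smul, smul_smul a a (D (c • Pc)), ← pow_two, smul_sub,
    smul_comm (a ^ 2) (1 / 3 : ℝ)]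

end Multilinear

/-! ### §2 Smoothness of the sheet ingredients: `N(W,r)`, `|W|²`, the blown-up projector `Π̃(W,r) = (r² − |W|²)•1 + N(W,r)` -/

section Smooth

/-- The sheet matrix `(t, W, r) ↦ N(W₀, W₁, r) = x x^* J` is smooth INTO `M₃(ℂ)` (entrywise polynomial, transferred from the Pi type along the identity continuous linear
equivalence, as in ★ `contDiff_wallCurve_arg`). [cite: Goldman1999, §3.1.1] -/
theorem contDiff_sheet_vecMulVec {n : WithTop ℕ∞} :
    ContDiff ℝ n fun p : ℝ × (Fin 2 → ℂ) × ℝ => vecMulVec ![p.2.1 0, p.2.1 1, (p.2.2 : ℂ)] (star ![p.2.1 0, p.2.1 1, (p.2.2 : ℂ)]) * J := by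
  have hx : ∀ i : Fin 3, ContDiff ℝ n fun p : ℝ × (Fin 2 → ℂ) × ℝ => (![p.2.1 0, p.2.1 1, (p.2.2 : ℂ)] : Fin 3 → ℂ) i := by
    intro i
    fin_cases i
    · exact ((ContinuousLinearMap.proj (R := ℝ) (φ := fun _ : Fin 2 => ℂ) 0).contDiff.comp (contDiff_fst.comp contDiff_snd))
    · exact ((ContinuousLinearMap.proj (R := ℝ) (φ := fun _ : Fin 2 => ℂ) 1).contDiff.comp (contDiff_fst.comp contDiff_snd))
    · exact (Complex.ofRealCLM.contDiff.comp (contDiff_snd.comp contDiff_snd))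
  have hpi : ContDiff ℝ n fun p : ℝ × (Fin 2 → ℂ) × ℝ => (fun i j => ((![p.2.1 0, p.2.1 1, (p.2.2 : ℂ)] : Fin 3 → ℂ) i *
      (starRingEnd ℂ) ((![p.2.1 0, p.2.1 1, (p.2.2 : ℂ)] : Fin 3 → ℂ) j) * J j j) : Fin 3 → Fin 3 → ℂ) := by
    refine contDiff_pi.2 fun i => contDiff_pi.2 fun j => ?_
    exact ((hx i).mul (Complex.conjCLE.contDiff.comp (hx j))).mul contDiff_const
  have hfun : (fun p : ℝ × (Fin 2 → ℂ) × ℝ => vecMulVec ![p.2.1 0, p.2.1 1, (p.2.2 : ℂ)] (star ![p.2.1 0, p.2.1 1, (p.2.2 : ℂ)]) * J) =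
      fun p => (fun i j => ((![p.2.1 0, p.2.1 1, (p.2.2 : ℂ)] : Fin 3 → ℂ) i * (starRingEnd ℂ) ((![p.2.1 0, p.2.1 1, (p.2.2 : ℂ)] : Fin 3 → ℂ) j) * J j j) :
        Fin 3 → Fin 3 → ℂ) := by
    funext p; ext i j
    rw [vecMulVec_star_mul_J_apply]
  rw [hfun]
  let e : (Fin 3 → Fin 3 → ℂ) ≃L[ℝ] Matrix (Fin 3) (Fin 3) ℂ := (LinearEquiv.refl ℝ (Fin 3 → Fin 3 → ℂ)).toContinuousLinearEquiv
  exact e.comp_contDiff_iff.2 hpi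

/-- `(t, W, r) ↦ |W|² = ‖W₀‖² + ‖W₁‖²` is smooth (a real polynomial). [cite: Rudin1980, §1.4] -/
theorem contDiff_sheet_nsq {n : WithTop ℕ∞} : ContDiff ℝ n fun p : ℝ × (Fin 2 → ℂ) × ℝ => nsq p.2.1 := by
  have h0 : ContDiff ℝ n fun p : ℝ × (Fin 2 → ℂ) × ℝ => p.2.1 0 :=
    (ContinuousLinearMap.proj (R := ℝ) (φ := fun _ : Fin 2 => ℂ) 0).contDiff.comp (contDiff_fst.comp contDiff_snd)
  have h1 : ContDiff ℝ n fun p : ℝ × (Fin 2 → ℂ) × ℝ => p.2.1 1 :=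
    (ContinuousLinearMap.proj (R := ℝ) (φ := fun _ : Fin 2 => ℂ) 1).contDiff.comp (contDiff_fst.comp contDiff_snd)
  unfold nsq
  exact ((contDiff_norm_sq ℝ).comp h0).add ((contDiff_norm_sq ℝ).comp h1)

/-- The blow-up parameter on the sheet, `(t, W, r) ↦ r² − |W|²`, is smooth. [cite: Rudin1980, §1.4] -/
theorem contDiff_sheet_sq_sub_nsq {n : WithTop ℕ∞} : ContDiff ℝ n fun p : ℝ × (Fin 2 → ℂ) × ℝ => p.2.2 ^ 2 - nsq p.2.1 :=
  ((contDiff_snd.comp contDiff_snd).pow 2).sub contDiff_sheet_nsq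

/-- **THE BLOWN-UP PROJECTOR IS SMOOTH ON THE SHEETS**: `(t, W, r) ↦ Π̃(W,r) = (r² − |W|²)•1 + N(W,r)` is smooth into `M₃(ℂ)` (on the sheet `r = √(ε+|W|²)` it equals
`ε • (1 − P(lift(chart(W∕√ε))))`, ★ `smul_one_add_vecMulVec_eq_sheet`). [cite: Goldman1999, §3.1.1] -/
theorem contDiff_sheet_blockProjTilde {n : WithTop ℕ∞} :
    ContDiff ℝ n fun p : ℝ × (Fin 2 → ℂ) × ℝ => (((p.2.2 ^ 2 - nsq p.2.1 : ℝ)) : ℂ) • (1 : Matrix (Fin 3) (Fin 3) ℂ) +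
      vecMulVec ![p.2.1 0, p.2.1 1, (p.2.2 : ℂ)] (star ![p.2.1 0, p.2.1 1, (p.2.2 : ℂ)]) * J :=
  ((Complex.ofRealCLM.contDiff.comp contDiff_sheet_sq_sub_nsq).smul contDiff_const).add contDiff_sheet_vecMulVec

end Smooth

/-! ### §3 THE TRANSVERSAL SHEET DATUM `Λ_χ`: support bound uniform in `t`, and `C²` smoothness for `Θ ∈ C⁴` -/

section Datum

variable {G : Type*} [NormedAddCommGroup G] [NormedSpace ℝ G]

/-- **THE `r²`-SUPPORT BOUND OF `Λ_χ`, UNIFORM IN `t`**: for `Θ` with compact support there is `S` such that the transversal sheet datum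
`Λ_χ(t,W,r) = ⅓·RHS(D²Θ(h)[u_t•·, u_t•·], Π̃(W,r)) − (r² − |W|²)•DΘ(h)[u_t•Π̃(W,r)]` (`h = u_t•1 + iζe^{−it∕2}•N(W,r)`, `Π̃ = (r² − |W|²)•1 + N(W,r)`) vanishes for `r² ≥ S`
(★ `exists_sq_support_bound_wallCurve` applied to `D²Θ` and `DΘ`, which inherit the compact support). [cite: Rudin1980, §1.4] [cite: Rogawski1990, §8.4 pp. 126–127] -/
theorem exists_sq_support_bound_transversalDatum {G : Type*} [NormedAddCommGroup G] [NormedSpace ℝ G] (Θ : Matrix (Fin 3) (Fin 3) ℂ → G)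
    (hΘc : HasCompactSupport Θ) (ζ : Circle) :
    ∃ S : ℝ, ∀ (t : ℝ) (W : Fin 2 → ℂ) (r : ℝ), S ≤ r ^ 2 →
      ((1 / 3 : ℝ) • ((∑ k, ∑ l, ((J k k * J l l).re • (iteratedFDeriv ℝ 2 Θ (((ζ * Circle.exp t : Circle) : ℂ) • (1 : Matrix (Fin 3) (Fin 3) ℂ) + (I * (ζ : ℂ) * Complex.exp (-(t / 2 : ℝ) * I)) • (vecMulVec ![W 0, W 1, (r : ℂ)] (star ![W 0, W 1, (r : ℂ)]) * J)) ![((ζ * Circle.exp t : Circle) : ℂ) • (Matrix.single k l (1 : ℂ) * (((r ^ 2 - nsq W : ℝ) : ℂ) • (1 : Matrix (Fin 3) (Fin 3) ℂ) + (vecMulVec ![W 0, W 1, (r : ℂ)] (star ![W 0, W 1, (r : ℂ)]) * J))), ((ζ * Circle.exp t : Circle) : ℂ) • ((((r ^ 2 - nsq W : ℝ) : ℂ) • (1 : Matrix (Fin 3) (Fin 3) ℂ) + (vecMulVec ![W 0, W 1, (r : ℂ)] (star ![W 0, W 1, (r : ℂ)]) * J)) * Matrix.single k l (1 : ℂ))]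 +
              iteratedFDeriv ℝ 2 Θ (((ζ * Circle.exp t : Circle) : ℂ) • (1 : Matrix (Fin 3) (Fin 3) ℂ) + (I * (ζ : ℂ) * Complex.exp (-(t / 2 : ℝ) * I)) • (vecMulVec ![W 0, W 1, (r : ℂ)] (star ![W 0, W 1, (r : ℂ)]) * J)) ![((ζ * Circle.exp t : Circle) : ℂ) • (I • (Matrix.single k l (1 : ℂ) * (((r ^ 2 - nsq W : ℝ) : ℂ) • (1 : Matrix (Fin 3) (Fin 3) ℂ) + (vecMulVec ![W 0, W 1, (r : ℂ)] (star ![W 0, W 1, (r : ℂ)]) * J)))), ((ζ * Circle.exp t : Circle) : ℂ) • (I • ((((r ^ 2 - nsq W : ℝ) : ℂ) • (1 : Matrix (Fin 3) (Fin 3) ℂ) + (vecMulVec ![W 0, W 1, (r : ℂ)] (star ![W 0, W 1, (r : ℂ)]) * J)) * Matrix.single k l (1 : ℂ)))]) -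
            iteratedFDeriv ℝ 2 Θ (((ζ * Circle.exp t : Circle) : ℂ) • (1 : Matrix (Fin 3) (Fin 3) ℂ) + (I * (ζ : ℂ) * Complex.exp (-(t / 2 : ℝ) * I)) • (vecMulVec ![W 0, W 1, (r : ℂ)] (star ![W 0, W 1, (r : ℂ)]) * J)) ![((ζ * Circle.exp t : Circle) : ℂ) • (Matrix.single k l (1 : ℂ) * (((r ^ 2 - nsq W : ℝ) : ℂ) • (1 : Matrix (Fin 3) (Fin 3) ℂ) + (vecMulVec ![W 0, W 1, (r : ℂ)] (star ![W 0, W 1, (r : ℂ)]) * J))), ((ζ * Circle.exp t : Circle) : ℂ) • (Matrix.single l k (1 : ℂ) * (((r ^ 2 - nsq W : ℝ) : ℂ) • (1 : Matrix (Fin 3) (Fin 3) ℂ) + (vecMulVec ![W 0, W 1, (r : ℂ)] (star ![W 0, W 1, (r : ℂ)]) * J)))] +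
            iteratedFDeriv ℝ 2 Θ (((ζ * Circle.exp t : Circle) : ℂ) • (1 : Matrix (Fin 3) (Fin 3) ℂ) + (I * (ζ : ℂ) * Complex.exp (-(t / 2 : ℝ) * I)) • (vecMulVec ![W 0, W 1, (r : ℂ)] (star ![W 0, W 1, (r : ℂ)]) * J)) ![((ζ * Circle.exp t : Circle) : ℂ) • (I • (Matrix.single k l (1 : ℂ) * (((r ^ 2 - nsq W : ℝ) : ℂ) • (1 : Matrix (Fin 3) (Fin 3) ℂ) + (vecMulVec ![W 0, W 1, (r : ℂ)] (star ![W 0, W 1, (r : ℂ)]) * J)))), ((ζ * Circle.exp t : Circle) : ℂ) • (I • (Matrix.single l k (1 : ℂ) * (((r ^ 2 - nsq W : ℝ) : ℂ) • (1 : Matrix (Fin 3) (Fin 3) ℂ) + (vecMulVec ![W 0, W 1, (r : ℂ)] (star ![W 0, W 1, (r : ℂ)]) * J))))])) -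
          iteratedFDeriv ℝ 2 Θ (((ζ * Circle.exp t : Circle) : ℂ) • (1 : Matrix (Fin 3) (Fin 3) ℂ) + (I * (ζ : ℂ) * Complex.exp (-(t / 2 : ℝ) * I)) • (vecMulVec ![W 0, W 1, (r : ℂ)] (star ![W 0, W 1, (r : ℂ)]) * J)) ![((ζ * Circle.exp t : Circle) : ℂ) • (I • (((r ^ 2 - nsq W : ℝ) : ℂ) • (1 : Matrix (Fin 3) (Fin 3) ℂ) + (vecMulVec ![W 0, W 1, (r : ℂ)] (star ![W 0, W 1, (r : ℂ)]) * J))), ((ζ * Circle.exp t : Circle) : ℂ) • (I • (((r ^ 2 - nsq W : ℝ) : ℂ) • (1 : Matrix (Fin 3) (Fin 3) ℂ) + (vecMulVec ![W 0, W 1, (r : ℂ)] (star ![W 0, W 1, (r : ℂ)]) * J)))]) -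
        (r ^ 2 - nsq W) • fderiv ℝ Θ (((ζ * Circle.exp t : Circle) : ℂ) • (1 : Matrix (Fin 3) (Fin 3) ℂ) + (I * (ζ : ℂ) * Complex.exp (-(t / 2 : ℝ) * I)) • (vecMulVec ![W 0, W 1, (r : ℂ)] (star ![W 0, W 1, (r : ℂ)]) * J)) (((ζ * Circle.exp t : Circle) : ℂ) • (((r ^ 2 - nsq W : ℝ) : ℂ) • (1 : Matrix (Fin 3) (Fin 3) ℂ) + (vecMulVec ![W 0, W 1, (r : ℂ)] (star ![W 0, W 1, (r : ℂ)]) * J)))) = 0 := by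
  obtain ⟨S₂, hS₂⟩ := exists_sq_support_bound_wallCurve (iteratedFDeriv ℝ 2 Θ) (hΘc.iteratedFDeriv 2) ζ
  obtain ⟨S₁, hS₁⟩ := exists_sq_support_bound_wallCurve (fderiv ℝ Θ) (hΘc.fderiv (𝕜 := ℝ)) ζ
  refine ⟨max S₁ S₂, fun t W r hr => ?_⟩
  have h2 := hS₂ t W r ((le_max_right _ _).trans hr)
  have h1 := hS₁ t W r ((le_max_left _ _).trans hr)
  simp only [h2, h1, _root_.zero_apply, smul_zero, add_zero, sub_zero, Finset.sum_const_zero]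

/-- The eigenvalue `u_t = ζe^{it}` is smooth in `(t, W, r)`. [cite: Rogawski1990, §8.4 pp. 126–127] -/
theorem contDiff_wallCurve_eigenvalue (ζ : Circle) {n : WithTop ℕ∞} : ContDiff ℝ n fun p : ℝ × (Fin 2 → ℂ) × ℝ => ((ζ * Circle.exp p.1 : Circle) : ℂ) := by
  have : (fun p : ℝ × (Fin 2 → ℂ) × ℝ => ((ζ * Circle.exp p.1 : Circle) : ℂ)) = fun p => (ζ : ℂ) * Complex.exp (((p.1 : ℝ) : ℂ) * I) := by
    funext p; rw [Circle.coe_mul, Circle.coe_exp]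
  rw [this]
  exact contDiff_const.mul ((( Complex.ofRealCLM.contDiff.comp contDiff_fst)).mul contDiff_const).cexp

/-- **THE TRANSVERSAL SHEET DATUM IS `C²`** jointly in `(t, W, r)` for `Θ` of class `C⁴` (two derivatives are spent inside `D²Θ`; the vector arguments are polynomial in `Π̃(W,r)`,
`u_t`, and `D²Θ(h)[X,Y] = (D(DΘ))(h)(X)(Y)`, Mathlib `iteratedFDeriv_two_apply`, is evaluated through `ContDiff.clm_apply`). [cite: Rogawski1990, §8.4 pp. 126–127] [cite: Rudin1980, §1.4] -/
theorem contDiff_two_transversalDatum (Θ : Matrix (Fin 3) (Fin 3) ℂ → G) (hΘ : ContDiff ℝ 4 Θ) (ζ : Circle) :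
    ContDiff ℝ 2 fun p : ℝ × (Fin 2 → ℂ) × ℝ =>
      ((1 / 3 : ℝ) • ((∑ k, ∑ l, ((J k k * J l l).re • (iteratedFDeriv ℝ 2 Θ (((ζ * Circle.exp p.1 : Circle) : ℂ) • (1 : Matrix (Fin 3) (Fin 3) ℂ) + (I * (ζ : ℂ) * Complex.exp (-(p.1 / 2 : ℝ) * I)) • (vecMulVec ![p.2.1 0, p.2.1 1, (p.2.2 : ℂ)] (star ![p.2.1 0, p.2.1 1, (p.2.2 : ℂ)]) * J)) ![((ζ * Circle.exp p.1 : Circle) : ℂ) • (Matrix.single k l (1 : ℂ) * (((p.2.2 ^ 2 - nsq p.2.1 : ℝ) : ℂ) • (1 : Matrix (Fin 3) (Fin 3) ℂ) + (vecMulVec ![p.2.1 0, p.2.1 1, (p.2.2 : ℂ)] (star ![p.2.1 0, p.2.1 1, (p.2.2 : ℂ)]) * J))), ((ζ * Circle.exp p.1 : Circle) : ℂ) • ((((p.2.2 ^ 2 - nsq p.2.1 : ℝ) : ℂ) • (1 : Matrix (Fin 3) (Fin 3) ℂ) + (vecMulVec ![p.2.1 0, p.2.1 1, (p.2.2 : ℂ)]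 (star ![p.2.1 0, p.2.1 1, (p.2.2 : ℂ)]) * J)) * Matrix.single k l (1 : ℂ))] +
              iteratedFDeriv ℝ 2 Θ (((ζ * Circle.exp p.1 : Circle) : ℂ) • (1 : Matrix (Fin 3) (Fin 3) ℂ) + (I * (ζ : ℂ) * Complex.exp (-(p.1 / 2 : ℝ) * I)) • (vecMulVec ![p.2.1 0, p.2.1 1, (p.2.2 : ℂ)] (star ![p.2.1 0, p.2.1 1, (p.2.2 : ℂ)]) * J)) ![((ζ * Circle.exp p.1 : Circle) : ℂ) • (I • (Matrix.single k l (1 : ℂ) * (((p.2.2 ^ 2 - nsq p.2.1 : ℝ) : ℂ) • (1 : Matrix (Fin 3) (Fin 3) ℂ) + (vecMulVec ![p.2.1 0, p.2.1 1, (p.2.2 : ℂ)] (star ![p.2.1 0, p.2.1 1, (p.2.2 : ℂ)]) * J)))), ((ζ * Circle.exp p.1 : Circle) : ℂ) • (I • ((((p.2.2 ^ 2 - nsq p.2.1 : ℝ) : ℂ) • (1 : Matrix (Fin 3) (Fin 3) ℂ) + (vecMulVec ![p.2.1 0, p.2.1 1, (p.2.2 : ℂ)] (star ![p.2.1 0,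 p.2.1 1, (p.2.2 : ℂ)]) * J)) * Matrix.single k l (1 : ℂ)))]) -
            iteratedFDeriv ℝ 2 Θ (((ζ * Circle.exp p.1 : Circle) : ℂ) • (1 : Matrix (Fin 3) (Fin 3) ℂ) + (I * (ζ : ℂ) * Complex.exp (-(p.1 / 2 : ℝ) * I)) • (vecMulVec ![p.2.1 0, p.2.1 1, (p.2.2 : ℂ)] (star ![p.2.1 0, p.2.1 1, (p.2.2 : ℂ)]) * J)) ![((ζ * Circle.exp p.1 : Circle) : ℂ) • (Matrix.single k l (1 : ℂ) * (((p.2.2 ^ 2 - nsq p.2.1 : ℝ) : ℂ) • (1 : Matrix (Fin 3) (Fin 3) ℂ) + (vecMulVec ![p.2.1 0, p.2.1 1, (p.2.2 : ℂ)] (star ![p.2.1 0, p.2.1 1, (p.2.2 : ℂ)]) * J))), ((ζ * Circle.exp p.1 : Circle) : ℂ) • (Matrix.single l k (1 : ℂ) * (((p.2.2 ^ 2 - nsq p.2.1 : ℝ) : ℂ) • (1 : Matrix (Fin 3) (Fin 3) ℂ) + (vecMulVec ![p.2.1 0, p.2.1 1, (p.2.2 : ℂ)] (star ![p.2.1 0,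 p.2.1 1, (p.2.2 : ℂ)]) * J)))] +
            iteratedFDeriv ℝ 2 Θ (((ζ * Circle.exp p.1 : Circle) : ℂ) • (1 : Matrix (Fin 3) (Fin 3) ℂ) + (I * (ζ : ℂ) * Complex.exp (-(p.1 / 2 : ℝ) * I)) • (vecMulVec ![p.2.1 0, p.2.1 1, (p.2.2 : ℂ)] (star ![p.2.1 0, p.2.1 1, (p.2.2 : ℂ)]) * J)) ![((ζ * Circle.exp p.1 : Circle) : ℂ) • (I • (Matrix.single k l (1 : ℂ) * (((p.2.2 ^ 2 - nsq p.2.1 : ℝ) : ℂ) • (1 : Matrix (Fin 3) (Fin 3) ℂ) + (vecMulVec ![p.2.1 0, p.2.1 1, (p.2.2 : ℂ)] (star ![p.2.1 0, p.2.1 1, (p.2.2 : ℂ)]) * J)))), ((ζ * Circle.exp p.1 : Circle) : ℂ) • (I • (Matrix.single l k (1 : ℂ) * (((p.2.2 ^ 2 - nsq p.2.1 : ℝ) : ℂ) • (1 : Matrix (Fin 3) (Fin 3) ℂ) + (vecMulVec ![p.2.1 0, p.2.1 1, (p.2.2 : ℂ)] (star ![p.2.1 0, p.2.1 1, (p.2.2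 : ℂ)]) * J))))])) -
          iteratedFDeriv ℝ 2 Θ (((ζ * Circle.exp p.1 : Circle) : ℂ) • (1 : Matrix (Fin 3) (Fin 3) ℂ) + (I * (ζ : ℂ) * Complex.exp (-(p.1 / 2 : ℝ) * I)) • (vecMulVec ![p.2.1 0, p.2.1 1, (p.2.2 : ℂ)] (star ![p.2.1 0, p.2.1 1, (p.2.2 : ℂ)]) * J)) ![((ζ * Circle.exp p.1 : Circle) : ℂ) • (I • (((p.2.2 ^ 2 - nsq p.2.1 : ℝ) : ℂ) • (1 : Matrix (Fin 3) (Fin 3) ℂ) + (vecMulVec ![p.2.1 0, p.2.1 1, (p.2.2 : ℂ)] (star ![p.2.1 0, p.2.1 1, (p.2.2 : ℂ)]) * J))), ((ζ * Circle.exp p.1 : Circle) : ℂ) • (I • (((p.2.2 ^ 2 - nsq p.2.1 : ℝ) : ℂ) • (1 : Matrix (Fin 3) (Fin 3) ℂ) + (vecMulVec ![p.2.1 0, p.2.1 1, (p.2.2 : ℂ)] (star ![p.2.1 0, p.2.1 1, (p.2.2 : ℂ)]) * J)))]) -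
        (p.2.2 ^ 2 - nsq p.2.1) • fderiv ℝ Θ (((ζ * Circle.exp p.1 : Circle) : ℂ) • (1 : Matrix (Fin 3) (Fin 3) ℂ) + (I * (ζ : ℂ) * Complex.exp (-(p.1 / 2 : ℝ) * I)) • (vecMulVec ![p.2.1 0, p.2.1 1, (p.2.2 : ℂ)] (star ![p.2.1 0, p.2.1 1, (p.2.2 : ℂ)]) * J)) (((ζ * Circle.exp p.1 : Circle) : ℂ) • (((p.2.2 ^ 2 - nsq p.2.1 : ℝ) : ℂ) • (1 : Matrix (Fin 3) (Fin 3) ℂ) + (vecMulVec ![p.2.1 0, p.2.1 1, (p.2.2 : ℂ)] (star ![p.2.1 0, p.2.1 1, (p.2.2 : ℂ)]) * J)))) := by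
  simp only [iteratedFDeriv_two_apply, Matrix.cons_val_zero, Matrix.cons_val_one]
  -- the ingredients
  have hh : ContDiff ℝ 2 fun p : ℝ × (Fin 2 → ℂ) × ℝ => (((ζ * Circle.exp p.1 : Circle) : ℂ) • (1 : Matrix (Fin 3) (Fin 3) ℂ) + (I * (ζ : ℂ) * Complex.exp (-(p.1 / 2 : ℝ) * I)) • (vecMulVec ![p.2.1 0, p.2.1 1, (p.2.2 : ℂ)] (star ![p.2.1 0, p.2.1 1, (p.2.2 : ℂ)]) * J)) := contDiff_wallCurve_arg ζ
  have hu : ContDiff ℝ 2 fun p : ℝ × (Fin 2 → ℂ) × ℝ => ((ζ * Circle.exp p.1 : Circle) : ℂ) := contDiff_wallCurve_eigenvalue ζ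
  have hP : ContDiff ℝ 2 fun p : ℝ × (Fin 2 → ℂ) × ℝ => (((p.2.2 ^ 2 - nsq p.2.1 : ℝ) : ℂ) • (1 : Matrix (Fin 3) (Fin 3) ℂ) + (vecMulVec ![p.2.1 0, p.2.1 1, (p.2.2 : ℂ)] (star ![p.2.1 0, p.2.1 1, (p.2.2 : ℂ)]) * J)) := contDiff_sheet_blockProjTilde
  have hε : ContDiff ℝ 2 fun p : ℝ × (Fin 2 → ℂ) × ℝ => p.2.2 ^ 2 - nsq p.2.1 := contDiff_sheet_sq_sub_nsq
  have h34 : (3 : WithTop ℕ∞) + 1 ≤ 4 := by norm_num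
  have h23 : (2 : WithTop ℕ∞) + 1 ≤ 3 := by norm_num
  -- NB (★ `UnitBallKCentralSecondOrder`): no type ascription here — `fderiv ℝ Θ` must keep the norm-derived topology on the spaces of continuous linear maps
  have hD2 := ((hΘ.fderiv_right h34).fderiv_right h23).comp hh
  have hD1 := ((hΘ.fderiv_right h34).of_le (show (2 : WithTop ℕ∞) ≤ 3 by norm_num)).comp hh
  -- evaluations of `D²Θ(h)` and `DΘ(h)` at smooth vector fields are `C²`
  have hev2 : ∀ X Y : ℝ × (Fin 2 → ℂ) × ℝ → Matrix (Fin 3) (Fin 3) ℂ, ContDiff ℝ 2 X → ContDiff ℝ 2 Y →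
      ContDiff ℝ 2 fun p => fderiv ℝ (fderiv ℝ Θ) (((ζ * Circle.exp p.1 : Circle) : ℂ) • (1 : Matrix (Fin 3) (Fin 3) ℂ) + (I * (ζ : ℂ) * Complex.exp (-(p.1 / 2 : ℝ) * I)) • (vecMulVec ![p.2.1 0, p.2.1 1, (p.2.2 : ℂ)] (star ![p.2.1 0, p.2.1 1, (p.2.2 : ℂ)]) * J)) (X p) (Y p) :=
    fun X Y hX hY => (hD2.clm_apply hX).clm_apply hY
  have hev1 : ∀ X : ℝ × (Fin 2 → ℂ) × ℝ → Matrix (Fin 3) (Fin 3) ℂ, ContDiff ℝ 2 X →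
      ContDiff ℝ 2 fun p => fderiv ℝ Θ (((ζ * Circle.exp p.1 : Circle) : ℂ) • (1 : Matrix (Fin 3) (Fin 3) ℂ) + (I * (ζ : ℂ) * Complex.exp (-(p.1 / 2 : ℝ) * I)) • (vecMulVec ![p.2.1 0, p.2.1 1, (p.2.2 : ℂ)] (star ![p.2.1 0, p.2.1 1, (p.2.2 : ℂ)]) * J)) (X p) := fun X hX => hD1.clm_apply hX
  -- the polynomial vector fields
  have hEP : ∀ k l : Fin 3, ContDiff ℝ 2 fun p : ℝ × (Fin 2 → ℂ) × ℝ => ((ζ * Circle.exp p.1 : Circle) : ℂ) • (Matrix.single k l (1 : ℂ) * (((p.2.2 ^ 2 - nsq p.2.1 : ℝ) : ℂ) • (1 : Matrix (Fin 3) (Fin 3) ℂ) + (vecMulVec ![p.2.1 0, p.2.1 1, (p.2.2 : ℂ)] (star ![p.2.1 0, p.2.1 1, (p.2.2 : ℂ)]) * J))) :=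
    fun k l => hu.smul (contDiff_const.mul hP)
  have hPE : ∀ k l : Fin 3, ContDiff ℝ 2 fun p : ℝ × (Fin 2 → ℂ) × ℝ => ((ζ * Circle.exp p.1 : Circle) : ℂ) • ((((p.2.2 ^ 2 - nsq p.2.1 : ℝ) : ℂ) • (1 : Matrix (Fin 3) (Fin 3) ℂ) + (vecMulVec ![p.2.1 0, p.2.1 1, (p.2.2 : ℂ)] (star ![p.2.1 0, p.2.1 1, (p.2.2 : ℂ)]) * J)) * Matrix.single k l (1 : ℂ)) :=
    fun k l => hu.smul (hP.mul contDiff_const)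
  have hEPI : ∀ k l : Fin 3, ContDiff ℝ 2 fun p : ℝ × (Fin 2 → ℂ) × ℝ => ((ζ * Circle.exp p.1 : Circle) : ℂ) • (I • (Matrix.single k l (1 : ℂ) * (((p.2.2 ^ 2 - nsq p.2.1 : ℝ) : ℂ) • (1 : Matrix (Fin 3) (Fin 3) ℂ) + (vecMulVec ![p.2.1 0, p.2.1 1, (p.2.2 : ℂ)] (star ![p.2.1 0, p.2.1 1, (p.2.2 : ℂ)]) * J)))) :=
    fun k l => hu.smul ((contDiff_const.mul hP).const_smul I)
  have hPEI : ∀ k l : Fin 3, ContDiff ℝ 2 fun p : ℝ × (Fin 2 → ℂ) × ℝ => ((ζ * Circle.exp p.1 : Circle) : ℂ) • (I • ((((p.2.2 ^ 2 - nsq p.2.1 : ℝ) : ℂ) • (1 : Matrix (Fin 3) (Fin 3) ℂ) + (vecMulVec ![p.2.1 0, p.2.1 1, (p.2.2 : ℂ)] (star ![p.2.1 0, p.2.1 1, (p.2.2 : ℂ)]) * J)) * Matrix.single k l (1 : ℂ))) :=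
    fun k l => hu.smul ((hP.mul contDiff_const).const_smul I)
  have hPI : ContDiff ℝ 2 fun p : ℝ × (Fin 2 → ℂ) × ℝ => ((ζ * Circle.exp p.1 : Circle) : ℂ) • (I • (((p.2.2 ^ 2 - nsq p.2.1 : ℝ) : ℂ) • (1 : Matrix (Fin 3) (Fin 3) ℂ) + (vecMulVec ![p.2.1 0, p.2.1 1, (p.2.2 : ℂ)] (star ![p.2.1 0, p.2.1 1, (p.2.2 : ℂ)]) * J))) := hu.smul (hP.const_smul I)
  have hP1 : ContDiff ℝ 2 fun p : ℝ × (Fin 2 → ℂ) × ℝ => ((ζ * Circle.exp p.1 : Circle) : ℂ) • (((p.2.2 ^ 2 - nsq p.2.1 : ℝ) : ℂ) • (1 : Matrix (Fin 3) (Fin 3) ℂ) + (vecMulVec ![p.2.1 0, p.2.1 1, (p.2.2 : ℂ)] (star ![p.2.1 0, p.2.1 1, (p.2.2 : ℂ)]) * J)) := hu.smul hP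
  -- assemble
  refine (ContDiff.const_smul (1 / 3 : ℝ) ((ContDiff.sum fun k _ => ContDiff.sum fun l _ => ?_).sub (hev2 _ _ hPI hPI))).sub (hε.smul (hev1 _ hP1))
  exact ((((hev2 _ _ (hEP k l) (hPE k l)).add (hev2 _ _ (hEPI k l) (hPEI k l))).const_smul _).sub (hev2 _ _ (hEP k l) (hEP l k))).add
    (hev2 _ _ (hEPI k l) (hEPI l k))

end Datum

/-! ### §4 THE BLOW-UP IDENTITY: `ε²` times the transversal pencil integrand at the chart point `w` IS `Λ_χ` at the sheet point over `W = √ε·w` -/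

section BlowUp

variable {G : Type*} [NormedAddCommGroup G] [NormedSpace ℝ G]

/-- **THE BLOW-UP IDENTITY FOR THE TRANSVERSAL INTEGRAND** (pointwise, every `Θ`, `ζ`, `t`, `w`, `ε ≥ 0`): with `u = ζe^{it}`, `b = iζe^{−it∕2}`, `N₁ = N(x(w,1))`, the (A2″) integrand
read at the chart point `w` with eigenvalue difference `v − u = −ε·b` (so `h = u•1 + (ε b)•N₁`, `Π = 1 + N₁`, ★ `one_sub_pencil_lift_chart`) satisfies
`ε² • [⅓·RHS(D²Θ(h)[u•·,u•·], 1 + N₁) − DΘ(h)[u•(1 + N₁)]] = Λ_χ(t, √ε•w, √(ε + |√ε•w|²))` — ★ `vecCons_sqrt_smul`, ★ `vecMulVec_real_smul_star_mul_J`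
(`N(x(√ε w, ε)) = ε N₁`), ★ `eq_sq_sqrt_sub_nsq` (`r² − |W|² = ε` on the sheet) and the degree-two homogeneity ★ `casimir_pencil_rhs_smul_multilinear`.  Together with ★ (A3-b)
`integral_bergmanVolume_eq_chart` and Mathlib `Measure.integral_comp_smul` (`d⁴(√ε w) = ε² d⁴w`) this turns `ε⁴ · N²Φ(k_ε)` into the sheet integral of `Λ_χ`.
[cite: Rogawski1990, §8.4 pp. 126–127] [cite: Goldman1999, §3.1.1] -/
theorem sq_smul_transversalPencil_eq_datum (Θ : Matrix (Fin 3) (Fin 3) ℂ → G) (ζ : Circle) (t : ℝ) (w : Fin 2 → ℂ) {ε : ℝ} (hε : 0 ≤ ε) :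
    ε ^ 2 • ((1 / 3 : ℝ) • ((∑ k, ∑ l, ((J k k * J l l).re • (iteratedFDeriv ℝ 2 Θ (((ζ * Circle.exp t : Circle) : ℂ) • (1 : Matrix (Fin 3) (Fin 3) ℂ) + ((((ε : ℝ) : ℂ)) * (I * (ζ : ℂ) * Complex.exp (-(t / 2 : ℝ) * I))) • (vecMulVec ![w 0, w 1, (Real.sqrt (1 + nsq w) : ℂ)] (star ![w 0, w 1, (Real.sqrt (1 + nsq w) : ℂ)]) * J)) ![((ζ * Circle.exp t : Circle) : ℂ) • (Matrix.single k l (1 : ℂ) * ((1 : Matrix (Fin 3) (Fin 3) ℂ) + (vecMulVec ![w 0, w 1, (Real.sqrt (1 + nsq w) : ℂ)] (star ![w 0, w 1, (Real.sqrt (1 + nsq w) : ℂ)]) * J))), ((ζ * Circle.exp t : Circle) : ℂ) • (((1 : Matrix (Fin 3) (Fin 3) ℂ) + (vecMulVec ![w 0, w 1, (Real.sqrt (1 + nsq w) : ℂ)] (star ![w 0, w 1, (Real.sqrt (1 + nsq w) : ℂ)]) * J)) * Matrix.single k l (1 : ℂ))] +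
              iteratedFDeriv ℝ 2 Θ (((ζ * Circle.exp t : Circle) : ℂ) • (1 : Matrix (Fin 3) (Fin 3) ℂ) + ((((ε : ℝ) : ℂ)) * (I * (ζ : ℂ) * Complex.exp (-(t / 2 : ℝ) * I))) • (vecMulVec ![w 0, w 1, (Real.sqrt (1 + nsq w) : ℂ)] (star ![w 0, w 1, (Real.sqrt (1 + nsq w) : ℂ)]) * J)) ![((ζ * Circle.exp t : Circle) : ℂ) • (I • (Matrix.single k l (1 : ℂ) * ((1 : Matrix (Fin 3) (Fin 3) ℂ) + (vecMulVec ![w 0, w 1, (Real.sqrt (1 + nsq w) : ℂ)] (star ![w 0, w 1, (Real.sqrt (1 + nsq w) : ℂ)]) * J)))), ((ζ * Circle.exp t : Circle) : ℂ) • (I • (((1 : Matrix (Fin 3) (Fin 3) ℂ) + (vecMulVec ![w 0, w 1, (Real.sqrt (1 + nsq w) : ℂ)] (star ![w 0, w 1, (Real.sqrt (1 + nsq w) : ℂ)]) * J)) * Matrix.single k l (1 : ℂ)))]) -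
            iteratedFDeriv ℝ 2 Θ (((ζ * Circle.exp t : Circle) : ℂ) • (1 : Matrix (Fin 3) (Fin 3) ℂ) + ((((ε : ℝ) : ℂ)) * (I * (ζ : ℂ) * Complex.exp (-(t / 2 : ℝ) * I))) • (vecMulVec ![w 0, w 1, (Real.sqrt (1 + nsq w) : ℂ)] (star ![w 0, w 1, (Real.sqrt (1 + nsq w) : ℂ)]) * J)) ![((ζ * Circle.exp t : Circle) : ℂ) • (Matrix.single k l (1 : ℂ) * ((1 : Matrix (Fin 3) (Fin 3) ℂ) + (vecMulVec ![w 0, w 1, (Real.sqrt (1 + nsq w) : ℂ)] (star ![w 0, w 1, (Real.sqrt (1 + nsq w) : ℂ)]) * J))), ((ζ * Circle.exp t : Circle) : ℂ) • (Matrix.single l k (1 : ℂ) * ((1 : Matrix (Fin 3) (Fin 3) ℂ) + (vecMulVec ![w 0, w 1, (Real.sqrt (1 + nsq w) : ℂ)] (star ![w 0, w 1, (Real.sqrt (1 + nsq w) : ℂ)]) * J)))] +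
            iteratedFDeriv ℝ 2 Θ (((ζ * Circle.exp t : Circle) : ℂ) • (1 : Matrix (Fin 3) (Fin 3) ℂ) + ((((ε : ℝ) : ℂ)) * (I * (ζ : ℂ) * Complex.exp (-(t / 2 : ℝ) * I))) • (vecMulVec ![w 0, w 1, (Real.sqrt (1 + nsq w) : ℂ)] (star ![w 0, w 1, (Real.sqrt (1 + nsq w) : ℂ)]) * J)) ![((ζ * Circle.exp t : Circle) : ℂ) • (I • (Matrix.single k l (1 : ℂ) * ((1 : Matrix (Fin 3) (Fin 3) ℂ) + (vecMulVec ![w 0, w 1, (Real.sqrt (1 + nsq w) : ℂ)] (star ![w 0, w 1, (Real.sqrt (1 + nsq w) : ℂ)]) * J)))), ((ζ * Circle.exp t : Circle) : ℂ) • (I • (Matrix.single l k (1 : ℂ) * ((1 : Matrix (Fin 3) (Fin 3) ℂ) + (vecMulVec ![w 0, w 1, (Real.sqrt (1 + nsq w) : ℂ)] (star ![w 0, w 1, (Real.sqrt (1 + nsq w) : ℂ)]) * J))))])) -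
          iteratedFDeriv ℝ 2 Θ (((ζ * Circle.exp t : Circle) : ℂ) • (1 : Matrix (Fin 3) (Fin 3) ℂ) + ((((ε : ℝ) : ℂ)) * (I * (ζ : ℂ) * Complex.exp (-(t / 2 : ℝ) * I))) • (vecMulVec ![w 0, w 1, (Real.sqrt (1 + nsq w) : ℂ)] (star ![w 0, w 1, (Real.sqrt (1 + nsq w) : ℂ)]) * J)) ![((ζ * Circle.exp t : Circle) : ℂ) • (I • ((1 : Matrix (Fin 3) (Fin 3) ℂ) + (vecMulVec ![w 0, w 1, (Real.sqrt (1 + nsq w) : ℂ)] (star ![w 0, w 1, (Real.sqrt (1 + nsq w) : ℂ)]) * J))), ((ζ * Circle.exp t : Circle) : ℂ) • (I • ((1 : Matrix (Fin 3) (Fin 3) ℂ) + (vecMulVec ![w 0, w 1, (Real.sqrt (1 + nsq w) : ℂ)] (star ![w 0, w 1, (Real.sqrt (1 + nsq w) : ℂ)]) * J)))]) -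
        fderiv ℝ Θ (((ζ * Circle.exp t : Circle) : ℂ) • (1 : Matrix (Fin 3) (Fin 3) ℂ) + ((((ε : ℝ) : ℂ)) * (I * (ζ : ℂ) * Complex.exp (-(t / 2 : ℝ) * I))) • (vecMulVec ![w 0, w 1, (Real.sqrt (1 + nsq w) : ℂ)] (star ![w 0, w 1, (Real.sqrt (1 + nsq w) : ℂ)]) * J)) (((ζ * Circle.exp t : Circle) : ℂ) • ((1 : Matrix (Fin 3) (Fin 3) ℂ) + (vecMulVec ![w 0, w 1, (Real.sqrt (1 + nsq w) : ℂ)] (star ![w 0, w 1, (Real.sqrt (1 + nsq w) : ℂ)]) * J)))) =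
      ((1 / 3 : ℝ) • ((∑ k, ∑ l, ((J k k * J l l).re • (iteratedFDeriv ℝ 2 Θ (((ζ * Circle.exp t : Circle) : ℂ) • (1 : Matrix (Fin 3) (Fin 3) ℂ) + (I * (ζ : ℂ) * Complex.exp (-(t / 2 : ℝ) * I)) • (vecMulVec ![(Real.sqrt ε • w) 0, (Real.sqrt ε • w) 1, (Real.sqrt (ε + nsq (Real.sqrt ε • w)) : ℂ)] (star ![(Real.sqrt ε • w) 0, (Real.sqrt ε • w) 1, (Real.sqrt (ε + nsq (Real.sqrt ε • w)) : ℂ)]) * J)) ![((ζ * Circle.exp t : Circle) : ℂ) • (Matrix.single k l (1 : ℂ) * (((Real.sqrt (ε + nsq (Real.sqrt ε • w)) ^ 2 - nsq (Real.sqrt ε • w) : ℝ) : ℂ) • (1 : Matrix (Fin 3) (Fin 3) ℂ) + (vecMulVec ![(Real.sqrt ε • w) 0, (Real.sqrt ε • w) 1, (Real.sqrt (ε + nsq (Real.sqrt ε • w)) : ℂ)] (star ![(Real.sqrt ε • w) 0, (Real.sqrt ε • w) 1, (Real.sqrt (ε + nsq (Real.sqrt ε • w)) : ℂ)]) * J))),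 ((ζ * Circle.exp t : Circle) : ℂ) • ((((Real.sqrt (ε + nsq (Real.sqrt ε • w)) ^ 2 - nsq (Real.sqrt ε • w) : ℝ) : ℂ) • (1 : Matrix (Fin 3) (Fin 3) ℂ) + (vecMulVec ![(Real.sqrt ε • w) 0, (Real.sqrt ε • w) 1, (Real.sqrt (ε + nsq (Real.sqrt ε • w)) : ℂ)] (star ![(Real.sqrt ε • w) 0, (Real.sqrt ε • w) 1, (Real.sqrt (ε + nsq (Real.sqrt ε • w)) : ℂ)]) * J)) * Matrix.single k l (1 : ℂ))] +
              iteratedFDeriv ℝ 2 Θ (((ζ * Circle.exp t : Circle) : ℂ) • (1 : Matrix (Fin 3) (Fin 3) ℂ) + (I * (ζ : ℂ) * Complex.exp (-(t / 2 : ℝ) * I)) • (vecMulVec ![(Real.sqrt ε • w) 0, (Real.sqrt ε • w) 1, (Real.sqrt (ε + nsq (Real.sqrt ε • w)) : ℂ)] (star ![(Real.sqrt ε • w) 0, (Real.sqrt ε • w) 1, (Real.sqrt (ε + nsq (Real.sqrt ε • w)) : ℂ)]) * J)) ![((ζ * Circle.exp t : Circle) : ℂ) • (I • (Matrix.single k l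 (1 : ℂ) * (((Real.sqrt (ε + nsq (Real.sqrt ε • w)) ^ 2 - nsq (Real.sqrt ε • w) : ℝ) : ℂ) • (1 : Matrix (Fin 3) (Fin 3) ℂ) + (vecMulVec ![(Real.sqrt ε • w) 0, (Real.sqrt ε • w) 1, (Real.sqrt (ε + nsq (Real.sqrt ε • w)) : ℂ)] (star ![(Real.sqrt ε • w) 0, (Real.sqrt ε • w) 1, (Real.sqrt (ε + nsq (Real.sqrt ε • w)) : ℂ)]) * J)))), ((ζ * Circle.exp t : Circle) : ℂ) • (I • ((((Real.sqrt (ε + nsq (Real.sqrt ε • w)) ^ 2 - nsq (Real.sqrt ε • w) : ℝ) : ℂ) • (1 : Matrix (Fin 3) (Fin 3) ℂ) + (vecMulVec ![(Real.sqrt ε • w) 0, (Real.sqrt ε • w) 1, (Real.sqrt (ε + nsq (Real.sqrt ε • w)) : ℂ)] (star ![(Real.sqrt ε • w) 0, (Real.sqrt ε • w) 1, (Real.sqrt (ε + nsq (Real.sqrt ε • w)) : ℂ)]) * J)) * Matrix.single k l (1 : ℂ)))]) -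
            iteratedFDeriv ℝ 2 Θ (((ζ * Circle.exp t : Circle) : ℂ) • (1 : Matrix (Fin 3) (Fin 3) ℂ) + (I * (ζ : ℂ) * Complex.exp (-(t / 2 : ℝ) * I)) • (vecMulVec ![(Real.sqrt ε • w) 0, (Real.sqrt ε • w) 1, (Real.sqrt (ε + nsq (Real.sqrt ε • w)) : ℂ)] (star ![(Real.sqrt ε • w) 0, (Real.sqrt ε • w) 1, (Real.sqrt (ε + nsq (Real.sqrt ε • w)) : ℂ)]) * J)) ![((ζ * Circle.exp t : Circle) : ℂ) • (Matrix.single k l (1 : ℂ) * (((Real.sqrt (ε + nsq (Real.sqrt ε • w)) ^ 2 - nsq (Real.sqrt ε • w) : ℝ) : ℂ) • (1 : Matrix (Fin 3) (Fin 3) ℂ) + (vecMulVec ![(Real.sqrt ε • w) 0, (Real.sqrt ε • w) 1, (Real.sqrt (ε + nsq (Real.sqrt ε • w)) : ℂ)] (star ![(Real.sqrt ε • w) 0, (Real.sqrt ε • w) 1, (Real.sqrt (ε + nsq (Real.sqrt ε • w)) : ℂ)]) * J))), ((ζ * Circle.exp t : Circle) : ℂ) • (Matrix.single l k (1 : ℂ)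 * (((Real.sqrt (ε + nsq (Real.sqrt ε • w)) ^ 2 - nsq (Real.sqrt ε • w) : ℝ) : ℂ) • (1 : Matrix (Fin 3) (Fin 3) ℂ) + (vecMulVec ![(Real.sqrt ε • w) 0, (Real.sqrt ε • w) 1, (Real.sqrt (ε + nsq (Real.sqrt ε • w)) : ℂ)] (star ![(Real.sqrt ε • w) 0, (Real.sqrt ε • w) 1, (Real.sqrt (ε + nsq (Real.sqrt ε • w)) : ℂ)]) * J)))] +
            iteratedFDeriv ℝ 2 Θ (((ζ * Circle.exp t : Circle) : ℂ) • (1 : Matrix (Fin 3) (Fin 3) ℂ) + (I * (ζ : ℂ) * Complex.exp (-(t / 2 : ℝ) * I)) • (vecMulVec ![(Real.sqrt ε • w) 0, (Real.sqrt ε • w) 1, (Real.sqrt (ε + nsq (Real.sqrt ε • w)) : ℂ)] (star ![(Real.sqrt ε • w) 0, (Real.sqrt ε • w) 1, (Real.sqrt (ε + nsq (Real.sqrt ε • w)) : ℂ)]) * J)) ![((ζ * Circle.exp t : Circle) : ℂ) • (I • (Matrix.single k l (1 : ℂ) * (((Real.sqrt (ε + nsq (Real.sqrt ε • w)) ^ 2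 - nsq (Real.sqrt ε • w) : ℝ) : ℂ) • (1 : Matrix (Fin 3) (Fin 3) ℂ) + (vecMulVec ![(Real.sqrt ε • w) 0, (Real.sqrt ε • w) 1, (Real.sqrt (ε + nsq (Real.sqrt ε • w)) : ℂ)] (star ![(Real.sqrt ε • w) 0, (Real.sqrt ε • w) 1, (Real.sqrt (ε + nsq (Real.sqrt ε • w)) : ℂ)]) * J)))), ((ζ * Circle.exp t : Circle) : ℂ) • (I • (Matrix.single l k (1 : ℂ) * (((Real.sqrt (ε + nsq (Real.sqrt ε • w)) ^ 2 - nsq (Real.sqrt ε • w) : ℝ) : ℂ) • (1 : Matrix (Fin 3) (Fin 3) ℂ) + (vecMulVec ![(Real.sqrt ε • w) 0, (Real.sqrt ε • w) 1, (Real.sqrt (ε + nsq (Real.sqrt ε • w)) : ℂ)] (star ![(Real.sqrt ε • w) 0, (Real.sqrt ε • w) 1, (Real.sqrt (ε + nsq (Real.sqrt ε • w)) : ℂ)]) * J))))])) -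
          iteratedFDeriv ℝ 2 Θ (((ζ * Circle.exp t : Circle) : ℂ) • (1 : Matrix (Fin 3) (Fin 3) ℂ) + (I * (ζ : ℂ) * Complex.exp (-(t / 2 : ℝ) * I)) • (vecMulVec ![(Real.sqrt ε • w) 0, (Real.sqrt ε • w) 1, (Real.sqrt (ε + nsq (Real.sqrt ε • w)) : ℂ)] (star ![(Real.sqrt ε • w) 0, (Real.sqrt ε • w) 1, (Real.sqrt (ε + nsq (Real.sqrt ε • w)) : ℂ)]) * J)) ![((ζ * Circle.exp t : Circle) : ℂ) • (I • (((Real.sqrt (ε + nsq (Real.sqrt ε • w)) ^ 2 - nsq (Real.sqrt ε • w) : ℝ) : ℂ) • (1 : Matrix (Fin 3) (Fin 3) ℂ) + (vecMulVec ![(Real.sqrt ε • w) 0, (Real.sqrt ε • w) 1, (Real.sqrt (ε + nsq (Real.sqrt ε • w)) : ℂ)] (star ![(Real.sqrt ε • w) 0, (Real.sqrt ε • w) 1, (Real.sqrt (ε + nsq (Real.sqrt ε • w)) : ℂ)]) * J))), ((ζ * Circle.exp t : Circle) : ℂ) • (I • (((Real.sqrt (ε + nsq (Real.sqrt ε • w))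 ^ 2 - nsq (Real.sqrt ε • w) : ℝ) : ℂ) • (1 : Matrix (Fin 3) (Fin 3) ℂ) + (vecMulVec ![(Real.sqrt ε • w) 0, (Real.sqrt ε • w) 1, (Real.sqrt (ε + nsq (Real.sqrt ε • w)) : ℂ)] (star ![(Real.sqrt ε • w) 0, (Real.sqrt ε • w) 1, (Real.sqrt (ε + nsq (Real.sqrt ε • w)) : ℂ)]) * J)))]) -
        (Real.sqrt (ε + nsq (Real.sqrt ε • w)) ^ 2 - nsq (Real.sqrt ε • w)) • fderiv ℝ Θ (((ζ * Circle.exp t : Circle) : ℂ) • (1 : Matrix (Fin 3) (Fin 3) ℂ) + (I * (ζ : ℂ) * Complex.exp (-(t / 2 : ℝ) * I)) • (vecMulVec ![(Real.sqrt ε • w) 0, (Real.sqrt ε • w) 1, (Real.sqrt (ε + nsq (Real.sqrt ε • w)) : ℂ)] (star ![(Real.sqrt ε • w) 0, (Real.sqrt ε • w) 1, (Real.sqrt (ε + nsq (Real.sqrt ε • w)) : ℂ)]) * J)) (((ζ * Circle.exp t : Circle) : ℂ) • (((Real.sqrt (ε + nsq (Real.sqrt ε • w)) ^ 2 - nsq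 (Real.sqrt ε • w) : ℝ) : ℂ) • (1 : Matrix (Fin 3) (Fin 3) ℂ) + (vecMulVec ![(Real.sqrt ε • w) 0, (Real.sqrt ε • w) 1, (Real.sqrt (ε + nsq (Real.sqrt ε • w)) : ℂ)] (star ![(Real.sqrt ε • w) 0, (Real.sqrt ε • w) 1, (Real.sqrt (ε + nsq (Real.sqrt ε • w)) : ℂ)]) * J)))) := by
  have hx := vecCons_sqrt_smul w hε
  have hN : vecMulVec ![(Real.sqrt ε • w) 0, (Real.sqrt ε • w) 1, (Real.sqrt (ε + nsq (Real.sqrt ε • w)) : ℂ)] (star ![(Real.sqrt ε • w) 0, (Real.sqrt ε • w) 1, (Real.sqrt (ε + nsq (Real.sqrt ε • w)) : ℂ)]) * J =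
      (((ε : ℝ) : ℂ)) • (vecMulVec ![w 0, w 1, (Real.sqrt (1 + nsq w) : ℂ)] (star ![w 0, w 1, (Real.sqrt (1 + nsq w) : ℂ)]) * J) := by
    rw [hx, vecMulVec_real_smul_star_mul_J _ hε]
  have hε' : 0 ≤ ε + nsq (Real.sqrt ε • w) := add_nonneg hε (nsq_nonneg _)
  have hr2 : Real.sqrt (ε + nsq (Real.sqrt ε • w)) ^ 2 - nsq (Real.sqrt ε • w) = ε := (eq_sq_sqrt_sub_nsq _ hε').symm
  rw [hN, hr2]
  have hP : (((ε : ℝ) : ℂ)) • (1 : Matrix (Fin 3) (Fin 3) ℂ) + (((ε : ℝ) : ℂ)) • (vecMulVec ![w 0, w 1, (Real.sqrt (1 + nsq w) : ℂ)] (star ![w 0, w 1, (Real.sqrt (1 + nsq w) : ℂ)]) * J) = (((ε : ℝ) : ℂ)) • ((1 : Matrix (Fin 3) (Fin 3) ℂ) + (vecMulVec ![w 0, w 1, (Real.sqrt (1 + nsq w) : ℂ)] (star ![w 0, w 1, (Real.sqrt (1 + nsq w) : ℂ)]) * J)) := (smul_add _ _ _).symm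
  have hh : ((ζ * Circle.exp t : Circle) : ℂ) • (1 : Matrix (Fin 3) (Fin 3) ℂ) + (I * (ζ : ℂ) * Complex.exp (-(t / 2 : ℝ) * I)) • ((((ε : ℝ) : ℂ)) • (vecMulVec ![w 0, w 1, (Real.sqrt (1 + nsq w) : ℂ)] (star ![w 0, w 1, (Real.sqrt (1 + nsq w) : ℂ)]) * J)) = (((ζ * Circle.exp t : Circle) : ℂ) • (1 : Matrix (Fin 3) (Fin 3) ℂ) + ((((ε : ℝ) : ℂ)) * (I * (ζ : ℂ) * Complex.exp (-(t / 2 : ℝ) * I))) • (vecMulVec ![w 0, w 1, (Real.sqrt (1 + nsq w) : ℂ)] (star ![w 0, w 1, (Real.sqrt (1 + nsq w) : ℂ)]) * J)) := by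
    rw [smul_smul, mul_comm (I * (ζ : ℂ) * Complex.exp (-(t / 2 : ℝ) * I)) (((ε : ℝ) : ℂ))]
  rw [hP, hh]
  -- degree two of the Casimir part, degree one of the gradient part (§1, abstract form; `exact` unifies at default transparency)
  exact sq_smul_third_casimir_sub_apply_eq (iteratedFDeriv ℝ 2 Θ (((ζ * Circle.exp t : Circle) : ℂ) • (1 : Matrix (Fin 3) (Fin 3) ℂ) + ((((ε : ℝ) : ℂ)) * (I * (ζ : ℂ) * Complex.exp (-(t / 2 : ℝ) * I))) • (vecMulVec ![w 0, w 1, (Real.sqrt (1 + nsq w) : ℂ)] (star ![w 0, w 1, (Real.sqrt (1 + nsq w) : ℂ)]) * J))) (fderiv ℝ Θ (((ζ * Circle.exp t : Circle) : ℂ) • (1 : Matrix (Fin 3) (Fin 3) ℂ) + ((((ε : ℝ) : ℂ)) * (I * (ζ : ℂ) * Complex.exp (-(t / 2 : ℝ) * I))) • (vecMulVec ![w 0, w 1, (Real.sqrt (1 + nsq w) : ℂ)] (star ![w 0, w 1, (Real.sqrt (1 + nsq w) : ℂ)]) * J))) ((ζ * Circle.exp t : Circle) : ℂ) ε ((1 :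 Matrix (Fin 3) (Fin 3) ℂ) + (vecMulVec ![w 0, w 1, (Real.sqrt (1 + nsq w) : ℂ)] (star ![w 0, w 1, (Real.sqrt (1 + nsq w) : ℂ)]) * J))

end BlowUp

/-! ### §5 ENGINE-T APPLIED: the transversal sheet integral along the wall curve is `C²` on `[0, δ]` -/

section Engine

variable {G : Type*} [NormedAddCommGroup G] [NormedSpace ℝ G]

/-- **THE TRANSVERSAL SHEET INTEGRAL IS `C²` ON `[0, δ]`** (`0 < δ < 2π∕3`): for `Θ` of class `C⁴` with compact support and `ζ ∈ S¹`,
`t ↦ ∫_{ℂ²} Λ_χ(t, W, √(2 sin(3t∕2) + |W|²)) d⁴W ∈ C²[0, δ]` — ONE application of ★ ENGINE-T `contDiffOn_two_integral_family` at the datum `Λ_χ` (§3: `C²` jointly, `r²`-support bound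
uniform in `t`) with sheet radius `ε(t) = 2 sin(3t∕2) = |v_t − u_t|` (★ `hasDerivAt_wallRadius`, ★ `wallRadius_nonneg∕pos`), verbatim as ★ `contDiffOn_two_wallCurve_sheetIntegral` does for `ψ`.
This is the `hχ` input of the (A4)-V bookkeeping ★ `quarter_sub_eq_of_wallGerms` up to the identification `χ(t) = m(t)²·N²Φ(k_t) = c·(this integral)` (orbital side: ★ p843385 → (A4-iv) bridge →
★ `sum_conj_frame_eq_casimir_pencil_multilinear` → ★ `integral_comp_pencil_orbit_eq_integral_map` → ★ `integral_bergmanVolume_eq_chart` → §4). [cite: Rogawski1990, §8.4 pp. 126–127] [cite: Rudin1980, §1.4] -/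
theorem contDiffOn_two_transversal_sheetIntegral (Θ : Matrix (Fin 3) (Fin 3) ℂ → G) (hΘ : ContDiff ℝ 4 Θ) (hΘc : HasCompactSupport Θ) (ζ : Circle)
    {δ : ℝ} (hδ : 0 < δ) (hδ' : δ < 2 * Real.pi / 3) :
    ContDiffOn ℝ 2 (fun t : ℝ => ∫ W : Fin 2 → ℂ,
      ((1 / 3 : ℝ) • ((∑ k, ∑ l, ((J k k * J l l).re • (iteratedFDeriv ℝ 2 Θ (((ζ * Circle.exp t : Circle) : ℂ) • (1 : Matrix (Fin 3) (Fin 3) ℂ) + (I * (ζ : ℂ) * Complex.exp (-(t / 2 : ℝ) * I)) • (vecMulVec ![W 0, W 1, (Real.sqrt (2 * Real.sin (3 * t / 2) + nsq W) : ℂ)] (star ![W 0, W 1, (Real.sqrt (2 * Real.sin (3 * t / 2) + nsq W) : ℂ)]) * J)) ![((ζ * Circle.exp t : Circle) : ℂ) • (Matrix.single k l (1 : ℂ) * (((Real.sqrt (2 * Real.sin (3 * t / 2) + nsq W) ^ 2 - nsq W : ℝ) : ℂ) • (1 : Matrix (Fin 3) (Fin 3) ℂ) + (vecMulVec ![W 0,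 W 1, (Real.sqrt (2 * Real.sin (3 * t / 2) + nsq W) : ℂ)] (star ![W 0, W 1, (Real.sqrt (2 * Real.sin (3 * t / 2) + nsq W) : ℂ)]) * J))), ((ζ * Circle.exp t : Circle) : ℂ) • ((((Real.sqrt (2 * Real.sin (3 * t / 2) + nsq W) ^ 2 - nsq W : ℝ) : ℂ) • (1 : Matrix (Fin 3) (Fin 3) ℂ) + (vecMulVec ![W 0, W 1, (Real.sqrt (2 * Real.sin (3 * t / 2) + nsq W) : ℂ)] (star ![W 0, W 1, (Real.sqrt (2 * Real.sin (3 * t / 2) + nsq W) : ℂ)]) * J)) * Matrix.single k l (1 : ℂ))] +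
              iteratedFDeriv ℝ 2 Θ (((ζ * Circle.exp t : Circle) : ℂ) • (1 : Matrix (Fin 3) (Fin 3) ℂ) + (I * (ζ : ℂ) * Complex.exp (-(t / 2 : ℝ) * I)) • (vecMulVec ![W 0, W 1, (Real.sqrt (2 * Real.sin (3 * t / 2) + nsq W) : ℂ)] (star ![W 0, W 1, (Real.sqrt (2 * Real.sin (3 * t / 2) + nsq W) : ℂ)]) * J)) ![((ζ * Circle.exp t : Circle) : ℂ) • (I • (Matrix.single k l (1 : ℂ) * (((Real.sqrt (2 * Real.sin (3 * t / 2) + nsq W) ^ 2 - nsq W : ℝ) : ℂ) • (1 : Matrix (Fin 3) (Fin 3) ℂ) + (vecMulVec ![W 0, W 1, (Real.sqrt (2 * Real.sin (3 * t / 2) + nsq W) : ℂ)] (star ![W 0, W 1, (Real.sqrt (2 * Real.sin (3 * t / 2) + nsq W) : ℂ)]) * J)))), ((ζ * Circle.exp t : Circle) : ℂ) • (I • ((((Real.sqrt (2 * Real.sin (3 * t / 2) + nsq W) ^ 2 - nsq W : ℝ) : ℂ) • (1 : Matrix (Fin 3) (Fin 3) ℂ) + (vecMulVec ![W 0, W 1,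 (Real.sqrt (2 * Real.sin (3 * t / 2) + nsq W) : ℂ)] (star ![W 0, W 1, (Real.sqrt (2 * Real.sin (3 * t / 2) + nsq W) : ℂ)]) * J)) * Matrix.single k l (1 : ℂ)))]) -
            iteratedFDeriv ℝ 2 Θ (((ζ * Circle.exp t : Circle) : ℂ) • (1 : Matrix (Fin 3) (Fin 3) ℂ) + (I * (ζ : ℂ) * Complex.exp (-(t / 2 : ℝ) * I)) • (vecMulVec ![W 0, W 1, (Real.sqrt (2 * Real.sin (3 * t / 2) + nsq W) : ℂ)] (star ![W 0, W 1, (Real.sqrt (2 * Real.sin (3 * t / 2) + nsq W) : ℂ)]) * J)) ![((ζ * Circle.exp t : Circle) : ℂ) • (Matrix.single k l (1 : ℂ) * (((Real.sqrt (2 * Real.sin (3 * t / 2) + nsq W) ^ 2 - nsq W : ℝ) : ℂ) • (1 : Matrix (Fin 3) (Fin 3) ℂ) + (vecMulVec ![W 0, W 1, (Real.sqrt (2 * Real.sin (3 * t / 2) + nsq W) : ℂ)] (star ![W 0, W 1, (Real.sqrt (2 * Real.sin (3 * t / 2) + nsq W) : ℂ)]) * J))), ((ζ * Circle.exp t : Circle)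 : ℂ) • (Matrix.single l k (1 : ℂ) * (((Real.sqrt (2 * Real.sin (3 * t / 2) + nsq W) ^ 2 - nsq W : ℝ) : ℂ) • (1 : Matrix (Fin 3) (Fin 3) ℂ) + (vecMulVec ![W 0, W 1, (Real.sqrt (2 * Real.sin (3 * t / 2) + nsq W) : ℂ)] (star ![W 0, W 1, (Real.sqrt (2 * Real.sin (3 * t / 2) + nsq W) : ℂ)]) * J)))] +
            iteratedFDeriv ℝ 2 Θ (((ζ * Circle.exp t : Circle) : ℂ) • (1 : Matrix (Fin 3) (Fin 3) ℂ) + (I * (ζ : ℂ) * Complex.exp (-(t / 2 : ℝ) * I)) • (vecMulVec ![W 0, W 1, (Real.sqrt (2 * Real.sin (3 * t / 2) + nsq W) : ℂ)] (star ![W 0, W 1, (Real.sqrt (2 * Real.sin (3 * t / 2) + nsq W) : ℂ)]) * J)) ![((ζ * Circle.exp t : Circle) : ℂ) • (I • (Matrix.single k l (1 : ℂ) * (((Real.sqrt (2 * Real.sin (3 * t / 2) + nsq W) ^ 2 - nsq W : ℝ) : ℂ) • (1 : Matrix (Fin 3) (Fin 3) ℂ) + (vecMulVec ![W 0, W 1,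 (Real.sqrt (2 * Real.sin (3 * t / 2) + nsq W) : ℂ)] (star ![W 0, W 1, (Real.sqrt (2 * Real.sin (3 * t / 2) + nsq W) : ℂ)]) * J)))), ((ζ * Circle.exp t : Circle) : ℂ) • (I • (Matrix.single l k (1 : ℂ) * (((Real.sqrt (2 * Real.sin (3 * t / 2) + nsq W) ^ 2 - nsq W : ℝ) : ℂ) • (1 : Matrix (Fin 3) (Fin 3) ℂ) + (vecMulVec ![W 0, W 1, (Real.sqrt (2 * Real.sin (3 * t / 2) + nsq W) : ℂ)] (star ![W 0, W 1, (Real.sqrt (2 * Real.sin (3 * t / 2) + nsq W) : ℂ)]) * J))))])) -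
          iteratedFDeriv ℝ 2 Θ (((ζ * Circle.exp t : Circle) : ℂ) • (1 : Matrix (Fin 3) (Fin 3) ℂ) + (I * (ζ : ℂ) * Complex.exp (-(t / 2 : ℝ) * I)) • (vecMulVec ![W 0, W 1, (Real.sqrt (2 * Real.sin (3 * t / 2) + nsq W) : ℂ)] (star ![W 0, W 1, (Real.sqrt (2 * Real.sin (3 * t / 2) + nsq W) : ℂ)]) * J)) ![((ζ * Circle.exp t : Circle) : ℂ) • (I • (((Real.sqrt (2 * Real.sin (3 * t / 2) + nsq W) ^ 2 - nsq W : ℝ) : ℂ) • (1 : Matrix (Fin 3) (Fin 3) ℂ) + (vecMulVec ![W 0, W 1, (Real.sqrt (2 * Real.sin (3 * t / 2) + nsq W) : ℂ)] (star ![W 0, W 1, (Real.sqrt (2 * Real.sin (3 * t / 2) + nsq W) : ℂ)]) * J))), ((ζ * Circle.exp t : Circle) : ℂ) • (I • (((Real.sqrt (2 * Real.sin (3 * t / 2) + nsq W) ^ 2 - nsq W : ℝ) : ℂ) • (1 : Matrix (Fin 3) (Fin 3) ℂ) + (vecMulVec ![W 0, W 1, (Real.sqrt (2 * Real.sin (3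 * t / 2) + nsq W) : ℂ)] (star ![W 0, W 1, (Real.sqrt (2 * Real.sin (3 * t / 2) + nsq W) : ℂ)]) * J)))]) -
        (Real.sqrt (2 * Real.sin (3 * t / 2) + nsq W) ^ 2 - nsq W) • fderiv ℝ Θ (((ζ * Circle.exp t : Circle) : ℂ) • (1 : Matrix (Fin 3) (Fin 3) ℂ) + (I * (ζ : ℂ) * Complex.exp (-(t / 2 : ℝ) * I)) • (vecMulVec ![W 0, W 1, (Real.sqrt (2 * Real.sin (3 * t / 2) + nsq W) : ℂ)] (star ![W 0, W 1, (Real.sqrt (2 * Real.sin (3 * t / 2) + nsq W) : ℂ)]) * J)) (((ζ * Circle.exp t : Circle) : ℂ) • (((Real.sqrt (2 * Real.sin (3 * t / 2) + nsq W) ^ 2 - nsq W : ℝ) : ℂ) • (1 : Matrix (Fin 3) (Fin 3) ℂ) + (vecMulVec ![W 0, W 1, (Real.sqrt (2 * Real.sin (3 * t / 2) + nsq W) : ℂ)] (star ![W 0, W 1, (Real.sqrt (2 * Real.sin (3 * t / 2) + nsq W) : ℂ)]) * J))))) (Icc 0 δ) := by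
  obtain ⟨S, hS⟩ := exists_sq_support_bound_transversalDatum Θ hΘc ζ
  have hε₂c : Continuous fun t : ℝ => -(9 / 2) * Real.sin (3 * t / 2) := by fun_prop
  exact contDiffOn_two_integral_family (T := 2 * Real.pi / 3)
    (Λ := fun p : ℝ × (Fin 2 → ℂ) × ℝ =>
      ((1 / 3 : ℝ) • ((∑ k, ∑ l, ((J k k * J l l).re • (iteratedFDeriv ℝ 2 Θ (((ζ * Circle.exp p.1 : Circle) : ℂ) • (1 : Matrix (Fin 3) (Fin 3) ℂ) + (I * (ζ : ℂ) * Complex.exp (-(p.1 / 2 : ℝ) * I)) • (vecMulVec ![p.2.1 0, p.2.1 1, (p.2.2 : ℂ)] (star ![p.2.1 0, p.2.1 1, (p.2.2 : ℂ)]) * J)) ![((ζ * Circle.exp p.1 : Circle) : ℂ) • (Matrix.single k l (1 : ℂ) * (((p.2.2 ^ 2 - nsq p.2.1 : ℝ) : ℂ) • (1 : Matrix (Fin 3) (Fin 3) ℂ) + (vecMulVec ![p.2.1 0, p.2.1 1, (p.2.2 : ℂ)] (star ![p.2.1 0, p.2.1 1, (p.2.2 : ℂ)]) * J))), ((ζ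 * Circle.exp p.1 : Circle) : ℂ) • ((((p.2.2 ^ 2 - nsq p.2.1 : ℝ) : ℂ) • (1 : Matrix (Fin 3) (Fin 3) ℂ) + (vecMulVec ![p.2.1 0, p.2.1 1, (p.2.2 : ℂ)] (star ![p.2.1 0, p.2.1 1, (p.2.2 : ℂ)]) * J)) * Matrix.single k l (1 : ℂ))] +
              iteratedFDeriv ℝ 2 Θ (((ζ * Circle.exp p.1 : Circle) : ℂ) • (1 : Matrix (Fin 3) (Fin 3) ℂ) + (I * (ζ : ℂ) * Complex.exp (-(p.1 / 2 : ℝ) * I)) • (vecMulVec ![p.2.1 0, p.2.1 1, (p.2.2 : ℂ)] (star ![p.2.1 0, p.2.1 1, (p.2.2 : ℂ)]) * J)) ![((ζ * Circle.exp p.1 : Circle) : ℂ) • (I • (Matrix.single k l (1 : ℂ) * (((p.2.2 ^ 2 - nsq p.2.1 : ℝ) : ℂ) • (1 : Matrix (Fin 3) (Fin 3) ℂ) + (vecMulVec ![p.2.1 0, p.2.1 1, (p.2.2 : ℂ)] (star ![p.2.1 0, p.2.1 1, (p.2.2 : ℂ)]) * J)))), ((ζ * Circle.exp p.1 : Circle)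 : ℂ) • (I • ((((p.2.2 ^ 2 - nsq p.2.1 : ℝ) : ℂ) • (1 : Matrix (Fin 3) (Fin 3) ℂ) + (vecMulVec ![p.2.1 0, p.2.1 1, (p.2.2 : ℂ)] (star ![p.2.1 0, p.2.1 1, (p.2.2 : ℂ)]) * J)) * Matrix.single k l (1 : ℂ)))]) -
            iteratedFDeriv ℝ 2 Θ (((ζ * Circle.exp p.1 : Circle) : ℂ) • (1 : Matrix (Fin 3) (Fin 3) ℂ) + (I * (ζ : ℂ) * Complex.exp (-(p.1 / 2 : ℝ) * I)) • (vecMulVec ![p.2.1 0, p.2.1 1, (p.2.2 : ℂ)] (star ![p.2.1 0, p.2.1 1, (p.2.2 : ℂ)]) * J)) ![((ζ * Circle.exp p.1 : Circle) : ℂ) • (Matrix.single k l (1 : ℂ) * (((p.2.2 ^ 2 - nsq p.2.1 : ℝ) : ℂ) • (1 : Matrix (Fin 3) (Fin 3) ℂ) + (vecMulVec ![p.2.1 0, p.2.1 1, (p.2.2 : ℂ)] (star ![p.2.1 0, p.2.1 1, (p.2.2 : ℂ)]) * J))), ((ζ * Circle.exp p.1 : Circle) : ℂ) • (Matrix.single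 l k (1 : ℂ) * (((p.2.2 ^ 2 - nsq p.2.1 : ℝ) : ℂ) • (1 : Matrix (Fin 3) (Fin 3) ℂ) + (vecMulVec ![p.2.1 0, p.2.1 1, (p.2.2 : ℂ)] (star ![p.2.1 0, p.2.1 1, (p.2.2 : ℂ)]) * J)))] +
            iteratedFDeriv ℝ 2 Θ (((ζ * Circle.exp p.1 : Circle) : ℂ) • (1 : Matrix (Fin 3) (Fin 3) ℂ) + (I * (ζ : ℂ) * Complex.exp (-(p.1 / 2 : ℝ) * I)) • (vecMulVec ![p.2.1 0, p.2.1 1, (p.2.2 : ℂ)] (star ![p.2.1 0, p.2.1 1, (p.2.2 : ℂ)]) * J)) ![((ζ * Circle.exp p.1 : Circle) : ℂ) • (I • (Matrix.single k l (1 : ℂ) * (((p.2.2 ^ 2 - nsq p.2.1 : ℝ) : ℂ) • (1 : Matrix (Fin 3) (Fin 3) ℂ) + (vecMulVec ![p.2.1 0, p.2.1 1, (p.2.2 : ℂ)] (star ![p.2.1 0, p.2.1 1, (p.2.2 : ℂ)]) * J)))), ((ζ * Circle.exp p.1 : Circle) : ℂ) • (I • (Matrix.single l k (1 : ℂ) *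 (((p.2.2 ^ 2 - nsq p.2.1 : ℝ) : ℂ) • (1 : Matrix (Fin 3) (Fin 3) ℂ) + (vecMulVec ![p.2.1 0, p.2.1 1, (p.2.2 : ℂ)] (star ![p.2.1 0, p.2.1 1, (p.2.2 : ℂ)]) * J))))])) -
          iteratedFDeriv ℝ 2 Θ (((ζ * Circle.exp p.1 : Circle) : ℂ) • (1 : Matrix (Fin 3) (Fin 3) ℂ) + (I * (ζ : ℂ) * Complex.exp (-(p.1 / 2 : ℝ) * I)) • (vecMulVec ![p.2.1 0, p.2.1 1, (p.2.2 : ℂ)] (star ![p.2.1 0, p.2.1 1, (p.2.2 : ℂ)]) * J)) ![((ζ * Circle.exp p.1 : Circle) : ℂ) • (I • (((p.2.2 ^ 2 - nsq p.2.1 : ℝ) : ℂ) • (1 : Matrix (Fin 3) (Fin 3) ℂ) + (vecMulVec ![p.2.1 0, p.2.1 1, (p.2.2 : ℂ)] (star ![p.2.1 0, p.2.1 1, (p.2.2 : ℂ)]) * J))), ((ζ * Circle.exp p.1 : Circle) : ℂ) • (I • (((p.2.2 ^ 2 - nsq p.2.1 : ℝ) : ℂ) • (1 : Matrix (Fin 3)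 (Fin 3) ℂ) + (vecMulVec ![p.2.1 0, p.2.1 1, (p.2.2 : ℂ)] (star ![p.2.1 0, p.2.1 1, (p.2.2 : ℂ)]) * J)))]) -
        (p.2.2 ^ 2 - nsq p.2.1) • fderiv ℝ Θ (((ζ * Circle.exp p.1 : Circle) : ℂ) • (1 : Matrix (Fin 3) (Fin 3) ℂ) + (I * (ζ : ℂ) * Complex.exp (-(p.1 / 2 : ℝ) * I)) • (vecMulVec ![p.2.1 0, p.2.1 1, (p.2.2 : ℂ)] (star ![p.2.1 0, p.2.1 1, (p.2.2 : ℂ)]) * J)) (((ζ * Circle.exp p.1 : Circle) : ℂ) • (((p.2.2 ^ 2 - nsq p.2.1 : ℝ) : ℂ) • (1 : Matrix (Fin 3) (Fin 3) ℂ) + (vecMulVec ![p.2.1 0, p.2.1 1, (p.2.2 : ℂ)] (star ![p.2.1 0, p.2.1 1, (p.2.2 : ℂ)]) * J)))))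
    (ε := fun t : ℝ => 2 * Real.sin (3 * t / 2)) (ε₁ := fun t : ℝ => 3 * Real.cos (3 * t / 2)) (ε₂ := fun t : ℝ => -(9 / 2) * Real.sin (3 * t / 2))
    (contDiff_two_transversalDatum Θ hΘ ζ) hS hasDerivAt_wallRadius hasDerivAt_wallRadius_deriv hε₂c (fun t ht => wallRadius_nonneg ht) (fun t ht => wallRadius_pos ht) hδ hδ'

end Engine

end Literature.Geometry.ComplexHyperbolic.BallModel

end
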